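import Mathlib
import HarnessLib
import Summits.Ventures.LatticeQCDFlow.Scoring.GaussianWelchBounds
import Summits.Ventures.LatticeQCDFlow.Scoring.GaussianStudentCountRate

/-!
# THE UNEQUAL-COUNT TWO-ARM (WELCH-TYPE) CALIBRATION IS NOMINAL UP TO `N(0,1)([−t,t])·√(2/min(n,m))`,
# UNIFORMLY IN THE VARIANCE RATIO

HONEST FRAMING: exact (Metropolis-corrected) sampling algorithms for lattice gauge theory;
figures of merit are autocorrelation/cost numbers at stated couplings and volumes; no
continuum-physics claim.

Venture `LatticeQCDFlow` (cell pub-lqcd), topic `Scoring`; FANOUT row 4 (`s0-u1-b`, GEN-33).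
NEW WORK of the cell (classical), no definition, nothing cited as a fact.

WHY (row 4).  `Scoring/GaussianWelchBounds` sandwiches the limiting pass probability `W` of row 4's
A-vs-B criterion with `a = n + 1`, `b = m + 1` batches and arbitrary asymptotic standard deviations
`α, β` between `λL_a(t) + λ'L_b(t)` and `N(0,1)([−t, t])`; `Scoring/GaussianStudentCountRate` gives
`L_{k+1}(t) ≥ N(0,1)([−t,t])(1 − √(2/k))`.  Together: `0 ≤ N(0,1)([−t,t]) − W ≤ N(0,1)([−t,t])·√(2/min(n,m))`
— the Behrens–Fisher-type limit is nominal up to an explicit `min(n,m)^{−1/2}`, for EVERY variance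
ratio (no Welch–Satterthwaite degrees of freedom needed for this statement), and `W → N(0,1)([−t,t])`
as both counts grow.

## Content

* **`gaussianReal_sub_welch_nonneg`**, **`gaussianReal_sub_welch_le_sqrt`** — the two-sided bound
  (`t ≥ 0`, `n, m ≥ 1`, `α²/a + β²/b > 0`).
* **`tendsto_welch_atTop`** — `W → N(0,1)([−t, t])` along `atTop ×ˢ atTop` in the two counts, for
  every `(α, β) ≠ (0, 0)` (arms of `p.1 + 2`, `p.2 + 2` batches).

Depends on `Scoring/GaussianWelchBounds`, `Scoring/GaussianStudentCountRate` (row 4 GEN-33).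
[ours] throughout.
-/

open MeasureTheory ProbabilityTheory Filter Topology Finset

namespace Summit.Ventures.LatticeQCDFlow.Scoring

open Set

section WelchRate

/-- `0 ≤ N(0,1)([−t,t]) − W` (`Scoring/GaussianWelchBounds`, restated as a difference). [ours] -/
theorem gaussianReal_sub_welch_nonneg {t : ℝ} (ht : 0 ≤ t) {n m : ℕ} (hn : 1 ≤ n) (hm : 1 ≤ m)
    {α β : ℝ} (hτ : 0 < α ^ 2 / ((n + 1 : ℕ) : ℝ) + β ^ 2 / ((m + 1 : ℕ) : ℝ)) :
    0 ≤ (gaussianReal 0 1).real (Icc (-t) t)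
      - (((Measure.pi fun _ : Fin (n + 1) => gaussianReal 0 1).prod
          (Measure.pi fun _ : Fin (m + 1) => gaussianReal 0 1))
        {p : (Fin (n + 1) → ℝ) × (Fin (m + 1) → ℝ) |
          (α * ((∑ i, p.1 i) / ((n + 1 : ℕ) : ℝ)) - β * ((∑ i, p.2 i) / ((m + 1 : ℕ) : ℝ))) ^ 2
            ≤ t ^ 2 * (α ^ 2 * (((∑ j, (p.1 j - (∑ i, p.1 i) / ((n + 1 : ℕ) : ℝ)) ^ 2)
                  / (((n + 1 : ℕ) : ℝ) - 1)) / ((n + 1 : ℕ) : ℝ))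
              + β ^ 2 * (((∑ j, (p.2 j - (∑ i, p.2 i) / ((m + 1 : ℕ) : ℝ)) ^ 2)
                  / (((m + 1 : ℕ) : ℝ) - 1)) / ((m + 1 : ℕ) : ℝ)))}).toReal :=
  sub_nonneg.2 (pi_gaussianReal_welch_le_gaussian ht hn hm hτ)

/-- **RATE FOR THE WELCH-TYPE CALIBRATION, UNIFORM IN THE VARIANCE RATIO**: for `t ≥ 0`,
`n, m ≥ 1` and weights with `α²/a + β²/b > 0`,
`N(0,1)([−t,t]) − W ≤ N(0,1)([−t,t]) · max(√(2/n), √(2/m))`. [ours] -/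
theorem gaussianReal_sub_welch_le_sqrt {t : ℝ} (ht : 0 ≤ t) {n m : ℕ} (hn : 1 ≤ n) (hm : 1 ≤ m)
    {α β : ℝ} (hτ : 0 < α ^ 2 / ((n + 1 : ℕ) : ℝ) + β ^ 2 / ((m + 1 : ℕ) : ℝ)) :
    (gaussianReal 0 1).real (Icc (-t) t)
      - (((Measure.pi fun _ : Fin (n + 1) => gaussianReal 0 1).prod
          (Measure.pi fun _ : Fin (m + 1) => gaussianReal 0 1))
        {p : (Fin (n + 1) → ℝ) × (Fin (m + 1) → ℝ) |
          (α * ((∑ i, p.1 i) / ((n + 1 : ℕ) : ℝ)) - β * ((∑ i, p.2 i) / ((m + 1 : ℕ) : ℝ))) ^ 2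
            ≤ t ^ 2 * (α ^ 2 * (((∑ j, (p.1 j - (∑ i, p.1 i) / ((n + 1 : ℕ) : ℝ)) ^ 2)
                  / (((n + 1 : ℕ) : ℝ) - 1)) / ((n + 1 : ℕ) : ℝ))
              + β ^ 2 * (((∑ j, (p.2 j - (∑ i, p.2 i) / ((m + 1 : ℕ) : ℝ)) ^ 2)
                  / (((m + 1 : ℕ) : ℝ) - 1)) / ((m + 1 : ℕ) : ℝ)))}).toReal
      ≤ (gaussianReal 0 1).real (Icc (-t) t) * max (Real.sqrt (2 / (n : ℝ))) (Real.sqrt (2 / (m : ℝ))) := by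
  have hmix := pi_gaussianReal_welch_ge_mixture ht n m hτ
  have hLa := gaussianReal_sub_studentRatio_le_sqrt ht hn
  have hLb := gaussianReal_sub_studentRatio_le_sqrt ht hm
  set Φ := (gaussianReal 0 1).real (Icc (-t) t) with hΦ
  set La := ((Measure.pi fun _ : Fin (n + 1) => gaussianReal 0 1)
        {z : Fin (n + 1) → ℝ | |z 0| ≤ t * Real.sqrt ((∑ j : Fin n, z j.succ ^ 2) / (n : ℝ))}).toReal
  set Lb := ((Measure.pi fun _ : Fin (m + 1) => gaussianReal 0 1)
        {z : Fin (m + 1) → ℝ | |z 0| ≤ t * Real.sqrt ((∑ j : Fin m, z j.succ ^ 2) / (m : ℝ))}).toReal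
  have ha : (0 : ℝ) < ((n + 1 : ℕ) : ℝ) := by positivity
  have hb : (0 : ℝ) < ((m + 1 : ℕ) : ℝ) := by positivity
  set la : ℝ := (α ^ 2 / ((n + 1 : ℕ) : ℝ)) / (α ^ 2 / ((n + 1 : ℕ) : ℝ) + β ^ 2 / ((m + 1 : ℕ) : ℝ))
  set lb : ℝ := (β ^ 2 / ((m + 1 : ℕ) : ℝ)) / (α ^ 2 / ((n + 1 : ℕ) : ℝ) + β ^ 2 / ((m + 1 : ℕ) : ℝ))
  have hla0 : 0 ≤ la := div_nonneg (div_nonneg (sq_nonneg _) ha.le) hτ.le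
  have hlb0 : 0 ≤ lb := div_nonneg (div_nonneg (sq_nonneg _) hb.le) hτ.le
  have hsum : la + lb = 1 := by
    simp only [la, lb]; rw [← add_div, div_self hτ.ne']
  have hΦ0 : 0 ≤ Φ := measureReal_nonneg
  set M := max (Real.sqrt (2 / (n : ℝ))) (Real.sqrt (2 / (m : ℝ))) with hM
  -- `La ≥ Φ(1 − M)`, `Lb ≥ Φ(1 − M)`
  have hLa' : Φ - Φ * M ≤ La := by
    have : Φ * Real.sqrt (2 / (n : ℝ)) ≤ Φ * M := mul_le_mul_of_nonneg_left (le_max_left _ _) hΦ0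
    linarith
  have hLb' : Φ - Φ * M ≤ Lb := by
    have : Φ * Real.sqrt (2 / (m : ℝ)) ≤ Φ * M := mul_le_mul_of_nonneg_left (le_max_right _ _) hΦ0
    linarith
  -- mixture ≥ Φ(1 − M)
  have hmix' : Φ - Φ * M ≤ la * La + lb * Lb := by
    have h1 : la * (Φ - Φ * M) ≤ la * La := mul_le_mul_of_nonneg_left hLa' hla0
    have h2 : lb * (Φ - Φ * M) ≤ lb * Lb := mul_le_mul_of_nonneg_left hLb' hlb0
    have h3 : la * (Φ - Φ * M) + lb * (Φ - Φ * M) = Φ - Φ * M := by rw [← add_mul, hsum, one_mul]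
    linarith
  linarith [hmix, hmix']

/-- **The Welch-type calibration tends to the nominal one as BOTH counts grow, for every variance
ratio**: with arms of `p.1 + 2` and `p.2 + 2` batches, `W → N(0,1)([−t, t])` along
`atTop ×ˢ atTop` (`t ≥ 0`, `(α, β) ≠ (0, 0)`). [ours] -/
theorem tendsto_welch_atTop {t : ℝ} (ht : 0 ≤ t) {α β : ℝ} (hαβ : 0 < α ^ 2 + β ^ 2) :
    Tendsto (fun p : ℕ × ℕ =>
      (((Measure.pi fun _ : Fin (p.1 + 1 + 1) => gaussianReal 0 1).prod
          (Measure.pi fun _ : Fin (p.2 + 1 + 1) => gaussianReal 0 1))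
        {w : (Fin (p.1 + 1 + 1) → ℝ) × (Fin (p.2 + 1 + 1) → ℝ) |
          (α * ((∑ i, w.1 i) / ((p.1 + 1 + 1 : ℕ) : ℝ)) - β * ((∑ i, w.2 i) / ((p.2 + 1 + 1 : ℕ) : ℝ))) ^ 2
            ≤ t ^ 2 * (α ^ 2 * (((∑ j, (w.1 j - (∑ i, w.1 i) / ((p.1 + 1 + 1 : ℕ) : ℝ)) ^ 2)
                  / (((p.1 + 1 + 1 : ℕ) : ℝ) - 1)) / ((p.1 + 1 + 1 : ℕ) : ℝ))
              + β ^ 2 * (((∑ j, (w.2 j - (∑ i, w.2 i) / ((p.2 + 1 + 1 : ℕ) : ℝ)) ^ 2)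
                  / (((p.2 + 1 + 1 : ℕ) : ℝ) - 1)) / ((p.2 + 1 + 1 : ℕ) : ℝ)))}).toReal)
      (atTop ×ˢ atTop) (𝓝 ((gaussianReal 0 1).real (Icc (-t) t))) := by
  set Φ := (gaussianReal 0 1).real (Icc (-t) t) with hΦ
  -- `τ² > 0` for every pair of counts
  have hτ : ∀ n m : ℕ, 0 < α ^ 2 / ((n + 1 + 1 : ℕ) : ℝ) + β ^ 2 / ((m + 1 + 1 : ℕ) : ℝ) := by
    intro n m
    have ha : (0 : ℝ) < ((n + 1 + 1 : ℕ) : ℝ) := by positivity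
    have hb : (0 : ℝ) < ((m + 1 + 1 : ℕ) : ℝ) := by positivity
    rcases (sq_nonneg α).eq_or_lt with h0 | hpos
    · have hb2 : 0 < β ^ 2 := by linarith
      exact add_pos_of_nonneg_of_pos (div_nonneg (sq_nonneg _) ha.le) (div_pos hb2 hb)
    · exact add_pos_of_pos_of_nonneg (div_pos hpos ha) (div_nonneg (sq_nonneg _) hb.le)
  -- the bound `Φ · max(√(2/(n+1)), √(2/(m+1)))` tends to `0`
  have hsq : Tendsto (fun k : ℕ => Real.sqrt (2 / ((k + 1 : ℕ) : ℝ))) atTop (𝓝 0) := by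
    have h1 : Tendsto (fun k : ℕ => (2 : ℝ) / ((k + 1 : ℕ) : ℝ)) atTop (𝓝 0) := by
      have h := (tendsto_const_div_atTop_nhds_zero_nat (2 : ℝ)).comp (tendsto_add_atTop_nat 1)
      exact h
    have h2 := (Real.continuous_sqrt.tendsto 0).comp h1
    rw [Real.sqrt_zero] at h2
    exact h2
  have hmax : Tendsto (fun p : ℕ × ℕ => Φ * max (Real.sqrt (2 / ((p.1 + 1 : ℕ) : ℝ)))
      (Real.sqrt (2 / ((p.2 + 1 : ℕ) : ℝ)))) (atTop ×ˢ atTop) (𝓝 0) := by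
    have h1 : Tendsto (fun p : ℕ × ℕ => Real.sqrt (2 / ((p.1 + 1 : ℕ) : ℝ))) (atTop ×ˢ atTop) (𝓝 0) :=
      hsq.comp (tendsto_fst (f := (atTop : Filter ℕ)) (g := (atTop : Filter ℕ)))
    have h2 : Tendsto (fun p : ℕ × ℕ => Real.sqrt (2 / ((p.2 + 1 : ℕ) : ℝ))) (atTop ×ˢ atTop) (𝓝 0) :=
      hsq.comp (tendsto_snd (f := (atTop : Filter ℕ)) (g := (atTop : Filter ℕ)))
    have h := (h1.max h2).const_mul Φ
    simpa using h
  -- squeeze `0 ≤ Φ − W ≤ bound`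
  have hdiff : Tendsto (fun p : ℕ × ℕ => Φ -
      (((Measure.pi fun _ : Fin (p.1 + 1 + 1) => gaussianReal 0 1).prod
          (Measure.pi fun _ : Fin (p.2 + 1 + 1) => gaussianReal 0 1))
        {w : (Fin (p.1 + 1 + 1) → ℝ) × (Fin (p.2 + 1 + 1) → ℝ) |
          (α * ((∑ i, w.1 i) / ((p.1 + 1 + 1 : ℕ) : ℝ)) - β * ((∑ i, w.2 i) / ((p.2 + 1 + 1 : ℕ) : ℝ))) ^ 2
            ≤ t ^ 2 * (α ^ 2 * (((∑ j, (w.1 j - (∑ i, w.1 i) / ((p.1 + 1 + 1 : ℕ) : ℝ)) ^ 2)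
                  / (((p.1 + 1 + 1 : ℕ) : ℝ) - 1)) / ((p.1 + 1 + 1 : ℕ) : ℝ))
              + β ^ 2 * (((∑ j, (w.2 j - (∑ i, w.2 i) / ((p.2 + 1 + 1 : ℕ) : ℝ)) ^ 2)
                  / (((p.2 + 1 + 1 : ℕ) : ℝ) - 1)) / ((p.2 + 1 + 1 : ℕ) : ℝ)))}).toReal)
      (atTop ×ˢ atTop) (𝓝 0) := by
    refine tendsto_of_tendsto_of_tendsto_of_le_of_le tendsto_const_nhds hmax (fun p => ?_) (fun p => ?_)
    · exact gaussianReal_sub_welch_nonneg ht (by omega) (by omega) (hτ p.1 p.2)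
    · exact gaussianReal_sub_welch_le_sqrt ht (by omega) (by omega) (hτ p.1 p.2)
  have := tendsto_const_nhds (x := Φ) (f := (atTop ×ˢ atTop : Filter (ℕ × ℕ))) |>.sub hdiff
  simp only [sub_zero] at this
  refine this.congr fun p => ?_
  ring


end WelchRate

end Summit.Ventures.LatticeQCDFlow.Scoring
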